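import Summits.Parity.GeneralizedHardyLittlewood.Theses.LiouvilleShiftedTables

/-!
# Crux-triage r1-3 (gen 2) evidence for stmt-Parity-14271 (`DilatedTableChowla`)

Card `positivity-quarantine` (ideator 3), claim (iii): "the positivity step kills the planner's
foreseen `SmallDilations` node outright — `TableChowla` with exponent `C + 4K + 1` gives the whole
range `q ≤ (log x)^K`, CLASS-SUP INCLUDED, for free".  This file kernel-checks that claim against
the REAL route declaration `TableChowla` (stmt-Parity-14270):

* `gramFourthMomentMonotone` — lever (P) (already proved independently by triagers r1-1 and
  r1-2; re-proved here through the same sum-of-squares identity `tr(G_T G_D) = ‖M_Tᵀ M_D‖²_F`, so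
  that this file is self-contained);
* `smallDilationsFromTable : SmallDilationsFromTable` — the card's typed implication
  `GramFourthMomentMonotone → TableChowla → SmallDilations`, i.e. the (log x)^{4K} bookkeeping;
* `smallDilations_of_tableChowla : TableChowla → SmallDilations` — unconditional in (P).

The `Prop`s `GramFourthMomentMonotone`, `BlockLeTable`, `SmallDilations`,
`SmallDilationsFromTable` and the functions `blockMoment`, `tableMoment` are restated VERBATIM from
`Summits/Parity/GeneralizedHardyLittlewood/Cruxes/DilatedTableChowla/Sketch.lean` (ideator 3),
which is not built on the farm and therefore cannot be imported.
-/

namespace Summit.Parity.GeneralizedHardyLittlewood.Cruxes.DilatedTableChowla.Triage3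

open scoped BigOperators
open Finset Real ArithmeticFunction
open Summit.Parity.GeneralizedHardyLittlewood.Theses.LiouvilleShiftedTables

/-! ## Verbatim restatements from `Sketch.lean` -/

/-- verbatim `Sketch.blockMoment`: the `(q;u,v)`-block fourth moment (summand of the crux
without the weight `q³`). -/
noncomputable def blockMoment (c : ℤ) (x A : ℝ) (q u v : ℕ) : ℝ :=
  ∑ a ∈ (Finset.Ioc ⌊A⌋₊ ⌊2 * A⌋₊).filter (fun a : ℕ => a ≡ u [MOD q]),
    ∑ a' ∈ (Finset.Ioc ⌊A⌋₊ ⌊2 * A⌋₊).filter (fun a' : ℕ => a' ≡ u [MOD q]),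
      (∑ b ∈ (Finset.Icc 1 ⌊x / A⌋₊).filter (fun b : ℕ => b ≡ v [MOD q]),
        (liouville (Int.toNat ((a : ℤ) * b + c)) : ℝ) *
          (liouville (Int.toNat ((a' : ℤ) * b + c)) : ℝ)) ^ 2

/-- verbatim `Sketch.tableMoment` (the summand of `TableChowla`). -/
noncomputable def tableMoment (c : ℤ) (x A : ℝ) : ℝ :=
  ∑ a ∈ Finset.Ioc ⌊A⌋₊ ⌊2 * A⌋₊, ∑ a' ∈ Finset.Ioc ⌊A⌋₊ ⌊2 * A⌋₊,
    (∑ b ∈ Finset.Icc 1 ⌊x / A⌋₊,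
      (liouville (Int.toNat ((a : ℤ) * b + c)) : ℝ) *
        (liouville (Int.toNat ((a' : ℤ) * b + c)) : ℝ)) ^ 2

/-- verbatim `Sketch.GramFourthMomentMonotone` (lever (P)). -/
def GramFourthMomentMonotone : Prop :=
  ∀ (f : ℕ → ℕ → ℝ) (S S' T T' : Finset ℕ), S ⊆ S' → T ⊆ T' →
    (∑ a ∈ S, ∑ a' ∈ S, (∑ b ∈ T, f a b * f a' b) ^ 2) ≤
      ∑ a ∈ S', ∑ a' ∈ S', (∑ b ∈ T', f a b * f a' b) ^ 2

/-- verbatim `Sketch.BlockLeTable`. -/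
def BlockLeTable : Prop :=
  ∀ (c : ℤ) (x A : ℝ) (q u v : ℕ), blockMoment c x A q u v ≤ tableMoment c x A

/-- verbatim `Sketch.SmallDilations` (the planner's foreseen `SmallDilations` layer,
class-sup included: `u v : ℕ → ℕ` are arbitrary class choices). -/
def SmallDilations : Prop :=
  ∀ c : ℤ, c ≠ 0 → ∀ δ : ℝ, 0 < δ → δ ≤ 1 / 12 → ∀ K : ℝ, 0 < K → ∀ C : ℝ, 0 < C →
    ∃ x₀ : ℝ, ∀ x : ℝ, x₀ ≤ x → ∀ A : ℝ, x ^ δ ≤ A → A ≤ x ^ (1 / 3 + δ) → ∀ u v : ℕ → ℕ,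
      (∑ q ∈ Finset.Icc 1 ⌊Real.log x ^ K⌋₊, (q : ℝ) ^ 3 * blockMoment c x A q (u q) (v q))
        ≤ x ^ 2 / Real.log x ^ C

/-- verbatim `Sketch.SmallDilationsFromTable`. -/
def SmallDilationsFromTable : Prop := GramFourthMomentMonotone → TableChowla → SmallDilations

/-! ## Lever (P): Gram fourth moments are monotone in rows and columns -/

theorem rows_mono (f : ℕ → ℕ → ℝ) (S S' T : Finset ℕ) (hS : S ⊆ S') :
    (∑ a ∈ S, ∑ a' ∈ S, (∑ b ∈ T, f a b * f a' b) ^ 2) ≤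
      ∑ a ∈ S', ∑ a' ∈ S', (∑ b ∈ T, f a b * f a' b) ^ 2 :=
  calc (∑ a ∈ S, ∑ a' ∈ S, (∑ b ∈ T, f a b * f a' b) ^ 2)
      ≤ ∑ a ∈ S, ∑ a' ∈ S', (∑ b ∈ T, f a b * f a' b) ^ 2 :=
        Finset.sum_le_sum fun _ _ =>
          Finset.sum_le_sum_of_subset_of_nonneg hS (fun _ _ _ => sq_nonneg _)
    _ ≤ ∑ a ∈ S', ∑ a' ∈ S', (∑ b ∈ T, f a b * f a' b) ^ 2 :=
        Finset.sum_le_sum_of_subset_of_nonneg hS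
          (fun _ _ _ => Finset.sum_nonneg (fun _ _ => sq_nonneg _))

/-- `tr(G_T G_D) = ‖M_Tᵀ M_D‖²_F`: the cross Gram term of two column sets is a sum of squares. -/
theorem cross_eq (f : ℕ → ℕ → ℝ) (S T D : Finset ℕ) :
    (∑ a ∈ S, ∑ a' ∈ S, (∑ b ∈ T, f a b * f a' b) * (∑ d ∈ D, f a d * f a' d)) =
      ∑ b ∈ T, ∑ d ∈ D, (∑ a ∈ S, f a b * f a d) ^ 2 := by
  have e1 : ∀ a a', (∑ b ∈ T, f a b * f a' b) * (∑ d ∈ D, f a d * f a' d) =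
      ∑ b ∈ T, ∑ d ∈ D, (f a b * f a d) * (f a' b * f a' d) := by
    intro a a'
    rw [Finset.sum_mul_sum]
    exact Finset.sum_congr rfl fun b _ => Finset.sum_congr rfl fun d _ => by ring
  have e2 : ∀ b d, (∑ a ∈ S, f a b * f a d) ^ 2 =
      ∑ a ∈ S, ∑ a' ∈ S, (f a b * f a d) * (f a' b * f a' d) := by
    intro b d
    rw [sq, Finset.sum_mul_sum]
  simp_rw [e1, e2]
  calc ∑ a ∈ S, ∑ a' ∈ S, ∑ b ∈ T, ∑ d ∈ D, (f a b * f a d) * (f a' b * f a' d)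
      = ∑ a ∈ S, ∑ b ∈ T, ∑ a' ∈ S, ∑ d ∈ D, (f a b * f a d) * (f a' b * f a' d) :=
        Finset.sum_congr rfl fun a _ => Finset.sum_comm
    _ = ∑ b ∈ T, ∑ a ∈ S, ∑ a' ∈ S, ∑ d ∈ D, (f a b * f a d) * (f a' b * f a' d) :=
        Finset.sum_comm
    _ = ∑ b ∈ T, ∑ a ∈ S, ∑ d ∈ D, ∑ a' ∈ S, (f a b * f a d) * (f a' b * f a' d) :=
        Finset.sum_congr rfl fun b _ => Finset.sum_congr rfl fun a _ => Finset.sum_comm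
    _ = ∑ b ∈ T, ∑ d ∈ D, ∑ a ∈ S, ∑ a' ∈ S, (f a b * f a d) * (f a' b * f a' d) :=
        Finset.sum_congr rfl fun b _ => Finset.sum_comm

/-- Column monotonicity at a fixed row set (the PSD half of (P)): with `T' = T ⊔ D`,
`Σ (g+h)² = Σ g² + 2 tr(G_T G_D) + Σ h² ≥ Σ g²`. -/
theorem cols_mono (f : ℕ → ℕ → ℝ) (S T T' : Finset ℕ) (hT : T ⊆ T') :
    (∑ a ∈ S, ∑ a' ∈ S, (∑ b ∈ T, f a b * f a' b) ^ 2) ≤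
      ∑ a ∈ S, ∑ a' ∈ S, (∑ b ∈ T', f a b * f a' b) ^ 2 := by
  have hU : T' = T ∪ (T' \ T) := (Finset.union_sdiff_of_subset hT).symm
  rw [hU]
  simp_rw [Finset.sum_union Finset.disjoint_sdiff]
  have expand : ∀ a a', (∑ b ∈ T, f a b * f a' b + ∑ d ∈ T' \ T, f a d * f a' d) ^ 2 =
      (∑ b ∈ T, f a b * f a' b) ^ 2 +
        (2 * ((∑ b ∈ T, f a b * f a' b) * (∑ d ∈ T' \ T, f a d * f a' d)) +
          (∑ d ∈ T' \ T, f a d * f a' d) ^ 2) := fun a a' => by ring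
  simp_rw [expand, Finset.sum_add_distrib, ← Finset.mul_sum]
  have h1 := cross_eq f S T (T' \ T)
  have h1' : 0 ≤ ∑ a ∈ S, ∑ a' ∈ S,
      (∑ b ∈ T, f a b * f a' b) * (∑ d ∈ T' \ T, f a d * f a' d) := by
    rw [h1]; exact Finset.sum_nonneg fun _ _ => Finset.sum_nonneg fun _ _ => sq_nonneg _
  have h2 : 0 ≤ ∑ a ∈ S, ∑ a' ∈ S, (∑ d ∈ T' \ T, f a d * f a' d) ^ 2 :=
    Finset.sum_nonneg fun _ _ => Finset.sum_nonneg fun _ _ => sq_nonneg _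
  linarith

/-- LEVER (P), sorry-free. -/
theorem gramFourthMomentMonotone : GramFourthMomentMonotone := fun f S S' T T' hS hT =>
  le_trans (rows_mono f S S' T hS) (cols_mono f S' T T' hT)

/-! ## Blocks are dominated by the full table -/

theorem blockMoment_nonneg (c : ℤ) (x A : ℝ) (q u v : ℕ) : 0 ≤ blockMoment c x A q u v := by
  unfold blockMoment
  exact Finset.sum_nonneg fun _ _ => Finset.sum_nonneg fun _ _ => sq_nonneg _

theorem blockLeTable_of_monotone (hP : GramFourthMomentMonotone) : BlockLeTable := by
  intro c x A q u v
  unfold blockMoment tableMoment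
  exact hP (fun a b => (liouville (Int.toNat ((a : ℤ) * b + c)) : ℝ)) _ _ _ _
    (Finset.filter_subset _ _) (Finset.filter_subset _ _)

theorem blockLeTable : BlockLeTable := blockLeTable_of_monotone gramFourthMomentMonotone

/-! ## The card's claim (iii): `SmallDilations` is free given `TableChowla` -/

/-- The typed implication of card `positivity-quarantine`:
`GramFourthMomentMonotone → TableChowla → SmallDilations`.  Bookkeeping: apply `TableChowla` with
exponent `C + 4K + 1`; for `q ≤ (log x)^K`, `q³ · F(q,u,v) ≤ (log x)^{3K} · tableMoment`, and there
are at most `(log x)^K` dilations, so the sum is `≤ x² (log x)^{4K} / (log x)^{C+4K+1}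
= x²/(log x)^{C+1} ≤ x²/(log x)^C` once `log x ≥ 1`. -/
theorem smallDilationsFromTable : SmallDilationsFromTable := by
  intro hP hT c hc δ hδ hδ' K hK C hC
  obtain ⟨x₀, hx₀⟩ := hT c hc δ hδ hδ' (C + 4 * K + 1) (by positivity)
  refine ⟨max x₀ (Real.exp 1), ?_⟩
  intro x hx A hA1 hA2 u v
  have hx0 : x₀ ≤ x := le_trans (le_max_left _ _) hx
  have hxe : Real.exp 1 ≤ x := le_trans (le_max_right _ _) hx
  have hL1 : 1 ≤ Real.log x := by
    rw [← Real.log_exp 1]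
    exact Real.log_le_log (Real.exp_pos 1) hxe
  have hL0 : 0 < Real.log x := lt_of_lt_of_le one_pos hL1
  have hTab : tableMoment c x A ≤ x ^ 2 / Real.log x ^ (C + 4 * K + 1) := by
    have h := hx₀ x hx0 A hA1 hA2
    simpa only [tableMoment] using h
  have hBlock : ∀ q, blockMoment c x A q (u q) (v q) ≤ tableMoment c x A :=
    fun q => blockLeTable_of_monotone hP c x A q (u q) (v q)
  have hK0 : 0 ≤ Real.log x ^ K := Real.rpow_nonneg hL0.le K
  have h3K0 : 0 ≤ Real.log x ^ (3 * K) := Real.rpow_nonneg hL0.le _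
  have hrhs0 : 0 ≤ x ^ 2 / Real.log x ^ (C + 4 * K + 1) :=
    div_nonneg (sq_nonneg x) (Real.rpow_nonneg hL0.le _)
  have hpow3 : (Real.log x ^ K) ^ (3 : ℕ) = Real.log x ^ (3 * K) := by
    rw [← Real.rpow_natCast, ← Real.rpow_mul hL0.le]
    congr 1
    push_cast
    ring
  have hterm : ∀ q ∈ Finset.Icc 1 ⌊Real.log x ^ K⌋₊,
      (q : ℝ) ^ 3 * blockMoment c x A q (u q) (v q) ≤
        Real.log x ^ (3 * K) * (x ^ 2 / Real.log x ^ (C + 4 * K + 1)) := by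
    intro q hq
    rw [Finset.mem_Icc] at hq
    have hqL : (q : ℝ) ≤ Real.log x ^ K := (Nat.le_floor_iff hK0).mp hq.2
    have hq3 : (q : ℝ) ^ 3 ≤ Real.log x ^ (3 * K) := by
      calc (q : ℝ) ^ 3 ≤ (Real.log x ^ K) ^ 3 := by gcongr
        _ = Real.log x ^ (3 * K) := hpow3
    calc (q : ℝ) ^ 3 * blockMoment c x A q (u q) (v q)
        ≤ Real.log x ^ (3 * K) * tableMoment c x A :=
          mul_le_mul hq3 (hBlock q) (blockMoment_nonneg _ _ _ _ _ _) h3K0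
      _ ≤ Real.log x ^ (3 * K) * (x ^ 2 / Real.log x ^ (C + 4 * K + 1)) :=
          mul_le_mul_of_nonneg_left hTab h3K0
  have hKne : Real.log x ^ K ≠ 0 := ne_of_gt (Real.rpow_pos_of_pos hL0 K)
  have h3Kne : Real.log x ^ (3 * K) ≠ 0 := ne_of_gt (Real.rpow_pos_of_pos hL0 _)
  have hC1ne : Real.log x ^ (C + 1) ≠ 0 := ne_of_gt (Real.rpow_pos_of_pos hL0 _)
  calc (∑ q ∈ Finset.Icc 1 ⌊Real.log x ^ K⌋₊, (q : ℝ) ^ 3 * blockMoment c x A q (u q) (v q))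
      ≤ ∑ q ∈ Finset.Icc 1 ⌊Real.log x ^ K⌋₊,
          Real.log x ^ (3 * K) * (x ^ 2 / Real.log x ^ (C + 4 * K + 1)) :=
        Finset.sum_le_sum hterm
    _ = (⌊Real.log x ^ K⌋₊ : ℝ) *
          (Real.log x ^ (3 * K) * (x ^ 2 / Real.log x ^ (C + 4 * K + 1))) := by
        rw [Finset.sum_const, Nat.card_Icc, nsmul_eq_mul]
        simp
    _ ≤ Real.log x ^ K * (Real.log x ^ (3 * K) * (x ^ 2 / Real.log x ^ (C + 4 * K + 1))) :=
        mul_le_mul_of_nonneg_right (Nat.floor_le hK0) (mul_nonneg h3K0 hrhs0)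
    _ = x ^ 2 / Real.log x ^ (C + 1) := by
        rw [show C + 4 * K + 1 = (C + 1) + K + 3 * K by ring, Real.rpow_add hL0,
          Real.rpow_add hL0]
        field_simp
    _ ≤ x ^ 2 / Real.log x ^ C := by
        apply div_le_div_of_nonneg_left (sq_nonneg x) (Real.rpow_pos_of_pos hL0 C)
        exact Real.rpow_le_rpow_of_exponent_le hL1 (by linarith)

/-- Card claim (iii) kernel-checked: the planner's `SmallDilations` layer (dilations
`q ≤ (log x)^K`, sup over classes) follows from `TableChowla` alone. -/
theorem smallDilations_of_tableChowla : TableChowla → SmallDilations :=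
  smallDilationsFromTable gramFourthMomentMonotone

end Summit.Parity.GeneralizedHardyLittlewood.Cruxes.DilatedTableChowla.Triage3
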